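import Summits.Ventures.HodgeRepro2.T5SU11HardyStrict
import Summits.Ventures.HodgeRepro2.T5SU11HardyStrictResolvent
import Summits.Ventures.HodgeRepro2.T5SU11ResolventIdentity
import Summits.Ventures.HodgeRepro2.T5SU11LiouvilleForm

/-!
# Summary IX — the ground-state identity, the strict spectral gap, the resolvent identity and the Sonin–Pólya /
Liouville bounds (rows 484–489), under uniform names

The headline statements of rows 484–489 re-exported:

* `hardy_identity_resolvent`, `hardy_remainder_integrable` — the ground-state identity
  `‖(G_λ f)′‖² − ‖G_λ f‖² = ∫ sinh 2t ((G_λ f)′Ξ − (G_λ f)Ξ′)²/Ξ²` on the range of the resolvent (row 484);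
* `hardy_strict`, `hardy_eq_zero`, `rayleigh_gt_one` — the strict Hardy inequality `‖u‖² < ‖u′‖²` for compactly
  supported `u ≢ 0` (row 485); `hardy_strict_resolvent`, `hardy_eq_source_zero`, `spectral_gap_strict` — the same
  on the range of the resolvent and the strict spectral gap `⟨f, G_λ f⟩ < −(λ−1)²‖G_λ f‖²` for `f ≢ 0` (row 487);
* `resolvent_uniqueness`, `resolvent_identity_ode`, `resolvent_identity_transform` — the resolvent identity
  `G_λ − G_{λ₂} = (μ − μ₂) G_λ G_{λ₂}` in ODE form and in the transform picture (row 488);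
* `sonin_polya_antitone`, `sonin_polya_monotone`, `bernstein_deriv_sq_le`, `abs_deriv_le_one`,
  `log_deriv_sq_le`, `extremal_values_decrease`, `deriv_sph_hyp_odd` — the Sonin–Pólya energy of the radial
  equation and its bounds on `φ_λ′` (rows 486, 489);
* `liouville_ode`, `liouville_one_concaveOn` — the Liouville form `w_λ″ = ((λ−1)² − 1/sinh² 2t) w_λ` of the radial
  equation and the concavity of `√(sinh 2t) Ξ(a_t)` (row 489).

Nothing is claimed about (N).

Blind lane: Mathlib + the HodgeRepro2 prefix only; no sorry; axioms ⊆ {propext, Classical.choice,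
Quot.sound}.
-/

namespace Summit.Ventures.HodgeRepro2.T5SU11RadialSummaryIX

open Filter Topology MeasureTheory intervalIntegral
open Set (Ioi Ici)
open T5SU11Cartan T5SU11SphericalFunction T5SU11SphericalGreen T5SU11HardyRemainderResolvent T5SU11HardyStrict
  T5SU11HardyStrictResolvent T5SU11ResolventIdentity T5SU11SoninPolyaGroup T5SU11LiouvilleForm

section measure

variable [MeasurableSpace Circle] [BorelSpace Circle]

/-! ### The ground-state identity and the strict Hardy inequality (rows 484, 485, 487) -/

variable {lam a b : ℝ} {f : ℝ → ℝ} (hlam : 1 < lam) (hf : ContinuousOn f (Ioi 0))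
  (ha : 0 < a) (hab : a ≤ b) (hfa : ∀ s, s ≤ a → f s = 0) (hfb : ∀ s, b ≤ s → f s = 0)

include hlam hf ha hab hfa hfb in
/-- **The ground-state identity on the range of the resolvent** (row 484). -/
theorem hardy_identity_resolvent :
    (∫ t in Ioi 0, Real.sinh (2 * t) * sphGreen' lam f a b t ^ 2)
        - (∫ t in Ioi 0, Real.sinh (2 * t) * sphGreen lam f a b t ^ 2)
      = ∫ t in Ioi 0, Real.sinh (2 * t) * (sphGreen' lam f a b t * sph 1 (hyp t)
          - sphGreen lam f a b t * deriv (fun t => sph 1 (hyp t)) t) ^ 2 / sph 1 (hyp t) ^ 2 :=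
  T5SU11HardyRemainderResolvent.hardy_identity_resolvent hlam hf ha hab hfa hfb

include hlam hf ha hab hfa hfb in
/-- **The remainder integrand is integrable on `(0, ∞)`** (row 484). -/
theorem hardy_remainder_integrable :
    IntegrableOn (fun t => Real.sinh (2 * t) * (sphGreen' lam f a b t * sph 1 (hyp t)
      - sphGreen lam f a b t * deriv (fun t => sph 1 (hyp t)) t) ^ 2 / sph 1 (hyp t) ^ 2) (Ioi 0) :=
  integrableOn_remainder hlam hf ha hab hfa hfb

include hlam hf ha hab hfa hfb in
/-- **The strict Hardy inequality on the range of the resolvent** (row 487): `‖G_λ f‖² < ‖(G_λ f)′‖²` for `f ≢ 0`. -/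
theorem hardy_strict_resolvent (hne : ∃ t, 0 < t ∧ f t ≠ 0) :
    ∫ t in Ioi 0, Real.sinh (2 * t) * sphGreen lam f a b t ^ 2
      < ∫ t in Ioi 0, Real.sinh (2 * t) * sphGreen' lam f a b t ^ 2 :=
  T5SU11HardyStrictResolvent.hardy_inequality_strict hlam hf ha hab hfa hfb hne

include hlam hf ha hab hfa hfb in
/-- **Equality in Hardy on the range of the resolvent forces the source to vanish** (row 487). -/
theorem hardy_eq_source_zero
    (heq : ∫ t in Ioi 0, Real.sinh (2 * t) * sphGreen lam f a b t ^ 2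
      = ∫ t in Ioi 0, Real.sinh (2 * t) * sphGreen' lam f a b t ^ 2) {t : ℝ} (ht : 0 < t) : f t = 0 :=
  T5SU11HardyStrictResolvent.eq_zero_of_hardy_eq hlam hf ha hab hfa hfb heq ht

include hlam hf ha hab hfa hfb in
/-- **The strict spectral gap** (row 487): `⟨f, G_λ f⟩ < −(λ−1)² ‖G_λ f‖²` for every source `f ≢ 0`, `λ > 1`. -/
theorem spectral_gap_strict (hne : ∃ t, 0 < t ∧ f t ≠ 0) :
    ∫ t in a..b, f t * sphGreen lam f a b t * Real.sinh (2 * t)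
      < -((lam - 1) ^ 2 * ∫ t in Ioi 0, Real.sinh (2 * t) * sphGreen lam f a b t ^ 2) :=
  inner_sphGreen_lt hlam hf ha hab hfa hfb hne

/-- **The strict Hardy inequality on compactly supported functions** (row 485): `‖u‖² < ‖u′‖²` for `u ≢ 0`. -/
theorem hardy_strict {u u' : ℝ → ℝ} (hu : ∀ t, 0 < t → HasDerivAt u (u' t) t)
    (hcu' : ContinuousOn u' (Ioi 0)) {a b : ℝ} (ha : 0 < a) (hab : a ≤ b)
    (hua : ∀ t, t ≤ a → u t = 0) (hub : ∀ t, b ≤ t → u t = 0)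
    (hu'a : ∀ t, t ≤ a → u' t = 0) (hu'b : ∀ t, b ≤ t → u' t = 0) (hne : ∃ t, u t ≠ 0) :
    ∫ t in Ioi 0, Real.sinh (2 * t) * u t ^ 2 < ∫ t in Ioi 0, Real.sinh (2 * t) * u' t ^ 2 :=
  T5SU11HardyStrict.hardy_inequality_strict hu hcu' ha hab hua hub hu'a hu'b hne

/-- **Equality in Hardy forces `u ≡ 0`** (row 485). -/
theorem hardy_eq_zero {u u' : ℝ → ℝ} (hu : ∀ t, 0 < t → HasDerivAt u (u' t) t)
    (hcu' : ContinuousOn u' (Ioi 0)) {a b : ℝ} (ha : 0 < a) (hab : a ≤ b)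
    (hua : ∀ t, t ≤ a → u t = 0) (hub : ∀ t, b ≤ t → u t = 0)
    (hu'a : ∀ t, t ≤ a → u' t = 0) (hu'b : ∀ t, b ≤ t → u' t = 0)
    (heq : ∫ t in Ioi 0, Real.sinh (2 * t) * u t ^ 2 = ∫ t in Ioi 0, Real.sinh (2 * t) * u' t ^ 2) (t : ℝ) :
    u t = 0 :=
  T5SU11HardyStrict.eq_zero_of_hardy_eq hu hcu' ha hab hua hub hu'a hu'b heq t

/-- **The Rayleigh quotient exceeds `ρ² = 1`** (row 485). -/
theorem rayleigh_gt_one {u u' : ℝ → ℝ} (hu : ∀ t, 0 < t → HasDerivAt u (u' t) t)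
    (hcu' : ContinuousOn u' (Ioi 0)) {a b : ℝ} (ha : 0 < a) (hab : a ≤ b)
    (hua : ∀ t, t ≤ a → u t = 0) (hub : ∀ t, b ≤ t → u t = 0)
    (hu'a : ∀ t, t ≤ a → u' t = 0) (hu'b : ∀ t, b ≤ t → u' t = 0) (hne : ∃ t, u t ≠ 0) :
    1 < (∫ t in Ioi 0, Real.sinh (2 * t) * u' t ^ 2) / ∫ t in Ioi 0, Real.sinh (2 * t) * u t ^ 2 :=
  T5SU11HardyStrict.rayleigh_gt_one hu hcu' ha hab hua hub hu'a hu'b hne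

/-! ### The resolvent identity (row 488) -/

/-- **Uniqueness for the inhomogeneous radial equation with an arbitrary source** (row 488). -/
theorem resolvent_uniqueness (lam : ℝ) {g v v' v'' w w' w'' : ℝ → ℝ}
    (hv : ∀ t, 0 < t → HasDerivAt v (v' t) t) (hv' : ∀ t, 0 < t → HasDerivAt v' (v'' t) t)
    (hvode : ∀ t, 0 < t → Real.sinh (2 * t) * v'' t + 2 * Real.cosh (2 * t) * v' t
      = lam * (lam - 2) * Real.sinh (2 * t) * v t + Real.sinh (2 * t) * g t)
    (hw : ∀ t, 0 < t → HasDerivAt w (w' t) t) (hw' : ∀ t, 0 < t → HasDerivAt w' (w'' t) t)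
    (hwode : ∀ t, 0 < t → Real.sinh (2 * t) * w'' t + 2 * Real.cosh (2 * t) * w' t
      = lam * (lam - 2) * Real.sinh (2 * t) * w t + Real.sinh (2 * t) * g t)
    {B : ℝ} (hB : ∀ᶠ t in 𝓝[>] (0 : ℝ), |v t| ≤ B) {C : ℝ} (hC : ∀ᶠ t in 𝓝[>] (0 : ℝ), |w t| ≤ C)
    (hvd : Tendsto (fun t => v t / sph lam (hyp t)) atTop (𝓝 0))
    (hwd : Tendsto (fun t => w t / sph lam (hyp t)) atTop (𝓝 0)) {t : ℝ} (ht : 0 < t) : v t = w t :=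
  eq_of_ode_of_bounded_of_decay lam hv hv' hvode hw hw' hwode hB hC hvd hwd ht

include hlam hf ha hab hfa hfb in
/-- **The resolvent identity in ODE form** (row 488): `G_λ f − G_{λ₂} f` is the unique bounded, `φ_λ`-decaying
solution of `(L − μ) v = (μ − μ₂) G_{λ₂} f`. -/
theorem resolvent_identity_ode {lam₂ : ℝ} (hlam₂ : 1 < lam₂) {v v' v'' : ℝ → ℝ}
    (hv : ∀ t, 0 < t → HasDerivAt v (v' t) t) (hv' : ∀ t, 0 < t → HasDerivAt v' (v'' t) t)
    (hvode : ∀ t, 0 < t → Real.sinh (2 * t) * v'' t + 2 * Real.cosh (2 * t) * v' t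
      = lam * (lam - 2) * Real.sinh (2 * t) * v t
        + Real.sinh (2 * t) * ((lam * (lam - 2) - lam₂ * (lam₂ - 2)) * sphGreen lam₂ f a b t))
    {B : ℝ} (hB : ∀ᶠ t in 𝓝[>] (0 : ℝ), |v t| ≤ B)
    (hdecay : Tendsto (fun t => v t / sph lam (hyp t)) atTop (𝓝 0)) {t : ℝ} (ht : 0 < t) :
    v t = sphGreen lam f a b t - sphGreen lam₂ f a b t :=
  eq_resolvent_diff_of_ode hlam hlam₂ hf ha hab hfa hfb hv hv' hvode hB hdecay ht

include hf ha hab hfa hfb in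
/-- **The resolvent identity in the transform picture** (row 488). -/
theorem resolvent_identity_transform {lam₂ lam' : ℝ} (h₁ : |lam' - 1| < lam - 1) (h₂ : |lam' - 1| < lam₂ - 1) :
    (∫ t in Ioi 0, sphGreen lam f a b t * sph lam' (hyp t) * Real.sinh (2 * t))
        - (∫ t in Ioi 0, sphGreen lam₂ f a b t * sph lam' (hyp t) * Real.sinh (2 * t))
      = (lam * (lam - 2) - lam₂ * (lam₂ - 2)) * (∫ t in Ioi 0, f t * sph lam' (hyp t) * Real.sinh (2 * t))
        / ((lam' * (lam' - 2) - lam * (lam - 2)) * (lam' * (lam' - 2) - lam₂ * (lam₂ - 2))) :=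
  T5SU11ResolventIdentity.resolvent_identity_transform hf ha hab hfa hfb h₁ h₂

/-! ### Sonin–Pólya and Liouville (rows 486, 489) -/

/-- **The Sonin–Pólya energy is antitone on `[0, ∞)` for `0 < λ < 2`** (row 486). -/
theorem sonin_polya_antitone {lam : ℝ} (h0 : 0 < lam) (h2 : lam < 2) :
    AntitoneOn (fun t => sph lam (hyp t) ^ 2 - (deriv (fun t => sph lam (hyp t)) t) ^ 2 / (lam * (lam - 2)))
      (Ici 0) :=
  energy_antitoneOn h0 h2

/-- **The Sonin–Pólya energy is monotone on `[0, ∞)` for `λ(λ−2) > 0`** (row 486). -/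
theorem sonin_polya_monotone {lam : ℝ} (hμ : 0 < lam * (lam - 2)) :
    MonotoneOn (fun t => sph lam (hyp t) ^ 2 - (deriv (fun t => sph lam (hyp t)) t) ^ 2 / (lam * (lam - 2)))
      (Ici 0) :=
  energy_monotoneOn hμ

/-- **The Bernstein-type bound** `φ_λ′(a_t)² ≤ λ(2−λ)(1 − φ_λ(a_t)²)` for every `t`, `0 < λ < 2` (rows 486, 489). -/
theorem bernstein_deriv_sq_le {lam : ℝ} (h0 : 0 < lam) (h2 : lam < 2) (t : ℝ) :
    (deriv (fun t => sph lam (hyp t)) t) ^ 2 ≤ lam * (2 - lam) * (1 - sph lam (hyp t) ^ 2) :=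
  deriv_sq_le' h0 h2 t

/-- **`|φ_λ′(a_t)| ≤ 1`** for `t ≥ 0`, `0 < λ < 2` (row 486). -/
theorem abs_deriv_le_one {lam : ℝ} (h0 : 0 < lam) (h2 : lam < 2) {t : ℝ} (ht : 0 ≤ t) :
    |deriv (fun t => sph lam (hyp t)) t| ≤ 1 :=
  T5SU11SoninPolyaGroup.abs_deriv_le_one h0 h2 ht

/-- **The logarithmic-derivative bound** `φ_λ′(a_t)² ≤ λ(λ−2) φ_λ(a_t)²` for `t ≥ 0`, `λ(λ−2) > 0` (row 486). -/
theorem log_deriv_sq_le {lam : ℝ} (hμ : 0 < lam * (lam - 2)) {t : ℝ} (ht : 0 ≤ t) :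
    (deriv (fun t => sph lam (hyp t)) t) ^ 2 ≤ lam * (lam - 2) * sph lam (hyp t) ^ 2 :=
  deriv_sq_le_mu_mul_sq hμ ht

/-- **The successive extremal values of `φ_λ` decrease** (row 489). -/
theorem extremal_values_decrease {lam : ℝ} (h0 : 0 < lam) (h2 : lam < 2) {s t : ℝ} (hs : 0 ≤ s) (hst : s ≤ t)
    (hcrit : deriv (fun t => sph lam (hyp t)) s = 0) : sph lam (hyp t) ^ 2 ≤ sph lam (hyp s) ^ 2 :=
  sq_le_sq_of_critical h0 h2 hs hst hcrit

/-- **`φ_λ′` is odd** (row 489). -/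
theorem deriv_sph_hyp_odd (lam t : ℝ) :
    deriv (fun t => sph lam (hyp t)) (-t) = -deriv (fun t => sph lam (hyp t)) t :=
  deriv_sph_hyp_neg lam t

/-- **The Liouville form of the radial equation** (row 489): `w_λ″ = ((λ−1)² − 1/sinh² 2t) w_λ`,
`w_λ = √(sinh 2t) φ_λ(a_t)`. -/
theorem liouville_ode (lam : ℝ) {t : ℝ} (ht : 0 < t) :
    HasDerivAt (liouW' lam) (((lam - 1) ^ 2 - 1 / Real.sinh (2 * t) ^ 2) * liouW lam t) t :=
  hasDerivAt_liouW' lam ht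

/-- **`√(sinh 2t) Ξ(a_t)` is concave on `(0, ∞)`** (row 489). -/
theorem liouville_one_concaveOn : ConcaveOn ℝ (Ioi 0) (liouW 1) :=
  liouW_one_concaveOn

end measure

end Summit.Ventures.HodgeRepro2.T5SU11RadialSummaryIX
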